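import Summits.QuantumFields.YangMills.Theorems.IR.TorusWilsonLoopRepOddGramBounds
import Summits.QuantumFields.YangMills.Theorems.IR.TorusWilsonLoopOddPlaquetteBound
import Summits.QuantumFields.YangMills.Theorems.IR.TensionRatioOfLoopFloor
import Summits.QuantumFields.YangMills.Theorems.IR.TensionStrongCoupling
import Literature.MathematicalPhysics.QuantumFieldTheory.LatticeGaugeStringTensionProofs
import HarnessLib

/-!
# Crux `IR` (stmt-QuantumFields-19354), line `tension-ratio`: the Seiler–Bachas bound `⟨W^π_{1×1}⟩^{hR} ≤ ⟨W^π_{h×R}⟩` for `π`-loops on the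
# ODD torus, and the loop floor REDUCED to the `π`-plaquette floor — `loopFloorSC_of_plaquetteFloorSC`, `ratioStrongCoupling_of_plaquetteFloorSC`

Helper module for item `stmt-QuantumFields-19354` (`--supports … --as helper`; it closes nothing).  §1 runs the derivation of p592927 ∕
`TorusWilsonLoopOddPlaquetteBound.lean` (p602802) on the odd-torus `π`-loop Gram inequalities of `TorusWilsonLoopRepOddGramBounds.lean` (p603554):
positivity, Bachas' log-convexity, `⟨W^π_{1×R}⟩^h ≤ ⟨W^π_{h×R}⟩` and `⟨W^π_{1×1}⟩^{hR} ≤ ⟨W^π_{h×R}⟩` for rectangular loops in an ARBITRARY continuous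
representation `π` under the `ρ`-Wilson state of the ODD torus (`L` odd, `L ≥ 3`, `β ≥ 0`, `h + 2 ≤ L`, `R + 2 ≤ L`, `d ≥ 2`).  §2 feeds it to the line:
`PlaquetteFloorSC → LoopFloorSC` (`Theorems/IR/TensionRatioDefs.lean` §7 → §6), hence `PlaquetteFloorSC → RatioStrongCoupling` (the registered rung
T2-sc) and `→ RatioStrongCouplingWindow`, by the landed `ratioStrongCoupling_of_loopFloorSC` (p601858).  After this file the registered strong-coupling
rungs of the line hinge on EXACTLY the volume-uniform strong-coupling leading order of ONE local observable, the mean `π`-plaquette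
(`w β^k ≤ ⟨χ_π(U_p)⟩_{2S+1,β}`), which the tree has for `π = r.ρ` special unitary (`k = 1`; cf. `TensionRatioSelf.lean`, p603055).
HONEST FRAMING: reflection-positivity bookkeeping + a kernel-checked reduction of FORMAT rungs inside `IR`'s known regime; `TensionFloor` ∕ `RatioFloorSC`
untouched and OPEN; the YM mass gap (Clay) is NOT proved; `R4` closes only the conditional rung `BalabanLadder.UV`.
Refs: E. Seiler, Phys. Rev. D 18 (1978) 482; C. Bachas, Phys. Rev. D 33 (1986) 2723, eq. (8); K. Osterwalder, E. Seiler, Ann. Phys. 110 (1978) 440.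
-/

set_option autoImplicit false

noncomputable section

open MeasureTheory Finset Filter Topology
open Literature.MathematicalPhysics.QuantumFieldTheory Literature.MathematicalPhysics.QuantumLattice

namespace Summit.QuantumFields.YangMills.Cruxes.IR.OddTorusRP

/-! ## §1 The Seiler–Bachas bounds for `π`-loops on the odd torus -/

section Rep

variable {d L N M : ℕ} {G : Type*} [Group G] [TopologicalSpace G] [IsTopologicalGroup G]
  [CompactSpace G] [MeasurableSpace G] [BorelSpace G]
  (ρ : G →* Matrix (Fin N) (Fin N) ℂ) (π : G →* Matrix (Fin M) (Fin M) ℂ)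

/-- **`⟨W^π_{0 × R}⟩_{Λ_L,β} = 1`** under the `ρ`-state (`M ≥ 1`, continuous `ρ`, any real `β`). -/
theorem wilsonExpectation_wilsonLoopRep_height_zero [NeZero L] (hρ : Continuous ρ) (β : ℝ) (hM : M ≠ 0)
    (x : Site d L) (i j : Fin d) (R : ℕ) :
    wilsonExpectation ρ β (wilsonLoop π x i j 0 R) = 1 := by
  haveI := isProbabilityMeasure_wilsonMeasure (d := d) (L := L) ρ hρ β
  have h : wilsonLoop π x i j 0 R = fun _ : GaugeConfig d L G => (1 : ℝ) :=
    funext fun U => GaugeBoot.wilsonLoop_height_zero π hM x i j R U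
  rw [h]
  simp [wilsonExpectation]

/-- **Positivity of rectangular `π`-loop expectations on the odd torus**: `L` odd, `L ≥ 3`, `β ≥ 0`, continuous `ρ` and `π`, `j ≠ 0`, `h + 2 ≤ L`:
`0 ≤ ⟨W^π_{h × R}⟩_{Λ_L,β}`. -/
theorem wilsonExpectation_wilsonLoopRep_nonneg_odd [NeZero d] [NeZero L] (hL : Odd L) (hL3 : 3 ≤ L)
    (hρ : Continuous ρ) {β : ℝ} (hβ : 0 ≤ β) (hπ : Continuous π) {j : Fin d} (hj : j ≠ 0) {h : ℕ} (hh : h + 2 ≤ L) (R : ℕ) :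
    0 ≤ wilsonExpectation ρ β (wilsonLoop π (0 : Site d L) 0 j h R) := by
  rcases Nat.even_or_odd' h with ⟨a, rfl | rfl⟩
  · have hG := gram_wilsonLoopRep_nonneg_even_of_odd ρ π hL hL3 hρ hβ hπ hj R {a}
      (fun s hs => by rw [Finset.mem_singleton] at hs; omega) (fun _ => 1)
    simpa [two_mul] using hG
  · have hG := gram_wilsonLoopRep_nonneg_odd_of_odd ρ π hL hL3 hρ hβ hπ hj R {a}
      (fun s hs => by rw [Finset.mem_singleton] at hs; omega) (fun _ => 1)
    simpa [two_mul] using hG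

/-- **Log-convexity in the time direction for `π`-loops on the odd torus** (Bachas (8)): `L` odd, `L ≥ 3`, `β ≥ 0`, continuous `ρ` and `π`,
`j ≠ 0`, `h + 4 ≤ L`: `⟨W^π_{(h+1) × R}⟩² ≤ ⟨W^π_{h × R}⟩ ⟨W^π_{(h+2) × R}⟩`. -/
theorem wilsonExpectation_wilsonLoopRep_sq_le_odd [NeZero d] [NeZero L] (hL : Odd L) (hL3 : 3 ≤ L)
    (hρ : Continuous ρ) {β : ℝ} (hβ : 0 ≤ β) (hπ : Continuous π) {j : Fin d} (hj : j ≠ 0) {h : ℕ} (hh : h + 4 ≤ L) (R : ℕ) :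
    wilsonExpectation ρ β (wilsonLoop π (0 : Site d L) 0 j (h + 1) R) ^ 2 ≤
      wilsonExpectation ρ β (wilsonLoop π (0 : Site d L) 0 j h R) *
        wilsonExpectation ρ β (wilsonLoop π (0 : Site d L) 0 j (h + 2) R) := by
  set W : ℕ → ℝ := fun n => wilsonExpectation ρ β (wilsonLoop π (0 : Site d L) 0 j n R) with hW
  rcases Nat.even_or_odd' h with ⟨a, rfl | rfl⟩
  · have hq : ∀ x y : ℝ,
        0 ≤ W (a + a) * x ^ 2 + 2 * W (a + a + 1) * x * y + W (a + a + 2) * y ^ 2 := by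
      intro x y
      have hG := gram_wilsonLoopRep_nonneg_even_of_odd ρ π hL hL3 hρ hβ hπ hj R {a, a + 1}
        (fun s hs => by
          rw [Finset.mem_insert, Finset.mem_singleton] at hs
          omega) (fun u => if u = a then x else y)
      exact quad_of_gram_pair (W := W) (h := fun s t => s + t) (a := a) rfl rfl (by omega) (by omega) hG
    have := StaticPotential.sq_le_mul_of_forall_quadratic_nonneg hq
    rw [two_mul]
    exact this
  · have hq : ∀ x y : ℝ,
        0 ≤ W (a + a + 1) * x ^ 2 + 2 * W (a + a + 2) * x * y + W (a + a + 3) * y ^ 2 := by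
      intro x y
      have hG := gram_wilsonLoopRep_nonneg_odd_of_odd ρ π hL hL3 hρ hβ hπ hj R {a, a + 1}
        (fun s hs => by
          rw [Finset.mem_insert, Finset.mem_singleton] at hs
          omega) (fun u => if u = a then x else y)
      exact quad_of_gram_pair (W := W) (h := fun s t => s + t + 1) (a := a) rfl rfl (by omega) (by omega) hG
    have := StaticPotential.sq_le_mul_of_forall_quadratic_nonneg hq
    rw [two_mul, show a + a + 1 + 1 = a + a + 2 by ring, show a + a + 1 + 2 = a + a + 3 by ring]
    exact this

/-- **`⟨W^π_{1 × R}⟩^h ≤ ⟨W^π_{h × R}⟩` on the odd torus**: `L` odd, `L ≥ 3`, `β ≥ 0`, continuous `ρ` and `π`, `M ≥ 1`, `j ≠ 0`, `h + 2 ≤ L`. -/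
theorem pow_wilsonExpectation_wilsonLoopRep_le_odd [NeZero d] [NeZero L] (hL : Odd L) (hL3 : 3 ≤ L)
    (hρ : Continuous ρ) {β : ℝ} (hβ : 0 ≤ β) (hπ : Continuous π) (hM : M ≠ 0) {j : Fin d} (hj : j ≠ 0) {h : ℕ}
    (hh : h + 2 ≤ L) (R : ℕ) :
    wilsonExpectation ρ β (wilsonLoop π (0 : Site d L) 0 j 1 R) ^ h ≤
      wilsonExpectation ρ β (wilsonLoop π (0 : Site d L) 0 j h R) := by
  set W : ℕ → ℝ := fun n => wilsonExpectation ρ β (wilsonLoop π (0 : Site d L) 0 j n R) with hW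
  have h0 : W 0 = 1 := wilsonExpectation_wilsonLoopRep_height_zero ρ π hρ β hM 0 0 j R
  exact pow_le_of_logConvex_nonneg (K := L - 2) h0
    (fun n hn => wilsonExpectation_wilsonLoopRep_nonneg_odd ρ π hL hL3 hρ hβ hπ hj (by omega) R)
    (fun n hn => wilsonExpectation_wilsonLoopRep_sq_le_odd ρ π hL hL3 hρ hβ hπ hj (by omega) R) h (by omega)

/-- **Symmetry of the torus `π`-loop expectations in the `(0,1)` plane**: `⟨W^π_{h × R}⟩ = ⟨W^π_{R × h}⟩` (coordinate exchange `0 ↔ 1` of the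
`ρ`-state, orientation reversal of the loop). -/
theorem wilsonExpectation_wilsonLoopRep_swap [NeZero d] [NeZero L] (hρ : Continuous ρ) (hπ : Continuous π) (β : ℝ) (h R : ℕ) :
    wilsonExpectation ρ β (wilsonLoop π (0 : Site d L) 0 1 h R) =
      wilsonExpectation ρ β (wilsonLoop π (0 : Site d L) 0 1 R h) := by
  rw [← StringTension.wilsonExpectation_comp_swap ρ hρ β (wilsonLoop π (0 : Site d L) 0 1 h R)]
  congr 1
  funext U
  exact StringTension.wilsonLoop_swap π hπ h R U

/-- **The Seiler–Bachas plaquette lower bound for `π`-loops on the ODD torus**: `⟨W^π_{1×1}⟩^{hR} ≤ ⟨W^π_{h×R}⟩_{Λ_L,β}` in the `(0,1)` plane,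
`L` odd, `L ≥ 3`, `β ≥ 0`, continuous `ρ` (action) and `π` (loop), `M ≥ 1`, `h + 2 ≤ L`, `R + 2 ≤ L`, `d ≥ 2`.  In particular an area law
`⟨W^π_{h×R}⟩ ≤ C^{2(h+R)} e^{−s h R}` on all large odd tori together with a `π`-plaquette floor `⟨W^π_{1×1}⟩ ≥ w > 0` forces `s ≤ −log w`. -/
theorem plaquette_pow_le_wilsonExpectation_wilsonLoopRep_odd [NeZero d] [NeZero L] (hd : 2 ≤ d) (hL : Odd L) (hL3 : 3 ≤ L)
    (hρ : Continuous ρ) {β : ℝ} (hβ : 0 ≤ β) (hπ : Continuous π) (hM : M ≠ 0) {h R : ℕ} (hh : h + 2 ≤ L) (hR : R + 2 ≤ L) :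
    wilsonExpectation ρ β (wilsonLoop π (0 : Site d L) 0 1 1 1) ^ (h * R) ≤
      wilsonExpectation ρ β (wilsonLoop π (0 : Site d L) 0 1 h R) := by
  have h10 : (1 : Fin d) ≠ 0 := by
    intro h01
    have := congrArg Fin.val h01
    rw [Fin.val_zero, Fin.val_one', Nat.one_mod_eq_one.mpr (by omega)] at this
    exact one_ne_zero this
  have hP : 0 ≤ wilsonExpectation ρ β (wilsonLoop π (0 : Site d L) 0 1 1 1) :=
    wilsonExpectation_wilsonLoopRep_nonneg_odd ρ π hL hL3 hρ hβ hπ h10 (h := 1) (by omega) 1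
  have hwidth : wilsonExpectation ρ β (wilsonLoop π (0 : Site d L) 0 1 1 1) ^ R ≤
      wilsonExpectation ρ β (wilsonLoop π (0 : Site d L) 0 1 1 R) := by
    rw [wilsonExpectation_wilsonLoopRep_swap ρ π hρ hπ β 1 R]
    exact pow_wilsonExpectation_wilsonLoopRep_le_odd ρ π hL hL3 hρ hβ hπ hM h10 hR 1
  calc wilsonExpectation ρ β (wilsonLoop π (0 : Site d L) 0 1 1 1) ^ (h * R)
      = (wilsonExpectation ρ β (wilsonLoop π (0 : Site d L) 0 1 1 1) ^ R) ^ h := by rw [mul_comm, pow_mul]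
    _ ≤ wilsonExpectation ρ β (wilsonLoop π (0 : Site d L) 0 1 1 R) ^ h := pow_le_pow_left₀ (pow_nonneg hP R) hwidth h
    _ ≤ wilsonExpectation ρ β (wilsonLoop π (0 : Site d L) 0 1 h R) :=
        pow_wilsonExpectation_wilsonLoopRep_le_odd ρ π hL hL3 hρ hβ hπ hM h10 hh R

end Rep

end Summit.QuantumFields.YangMills.Cruxes.IR.OddTorusRP

/-! ## §2 The line: the loop floor from the `π`-plaquette floor, and T2-sc from the `π`-plaquette floor -/

namespace Summit.QuantumFields.YangMills.Cruxes.IR.TensionRatio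

open Summit.QuantumFields.YangMills.Cruxes.IR.OddTorusRP (plaquette_pow_le_wilsonExpectation_wilsonLoopRep_odd)

/-- **`PlaquetteFloorSC → LoopFloorSC` (real proof).**  A `π`-plaquette floor `wβ^k ≤ ⟨χ_π(U_p)⟩_{2S+1}` on all large odd tori and the odd-torus
Seiler–Bachas bound for `π`-loops give `(wβ^k)^{n²} ≤ ⟨χ_π(W_{n×n})⟩_{2S+1} = |torusRect …|` for `n ≥ 1`, `S ≥ max S₀ n`. -/
theorem loopFloorSC_of_plaquetteFloorSC (hP : PlaquetteFloorSC) : LoopFloorSC := by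
  intro G _ _ _ _ hG hsc
  letI : MeasurableSpace G := borel G
  haveI : BorelSpace G := ⟨rfl⟩
  intro r N π z ω hN hπ hz hω hπz
  obtain ⟨βP, hβP, k, w, hw, hfloor⟩ := hP G hG hsc r N π z ω hN hπ hz hω hπz
  refine ⟨βP, hβP, k, w, hw, fun β hβ0 hβP' n hn => ?_⟩
  obtain ⟨S₀, hS₀⟩ := hfloor β hβ0 hβP'
  refine ⟨max S₀ n, fun S hS => ?_⟩
  have hS0 : S₀ ≤ S := (le_max_left _ _).trans hS
  have hnS : n ≤ S := (le_max_right _ _).trans hS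
  have hodd : Odd (2 * S + 1) := ⟨S, rfl⟩
  have h1 := hS₀ S hS0
  rw [torusRect_eq_wilsonExpectation] at h1 ⊢
  have hSB := plaquette_pow_le_wilsonExpectation_wilsonLoopRep_odd (d := 4) (L := 2 * S + 1) r.ρ π (by norm_num) hodd (by omega)
    r.continuous hβ0.le hπ (show N ≠ 0 by omega) (h := n) (R := n) (by omega) (by omega)
  have hwk : 0 ≤ w * β ^ k := (mul_pos hw (pow_pos hβ0 k)).le
  calc (w * β ^ k) ^ (n * n)
      ≤ wilsonExpectation r.ρ β (wilsonLoop π (0 : Literature.MathematicalPhysics.QuantumFieldTheory.Site 4 (2 * S + 1)) 0 1 1 1) ^ (n * n) :=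
        pow_le_pow_left₀ hwk h1 _
    _ ≤ wilsonExpectation r.ρ β (wilsonLoop π (0 : Literature.MathematicalPhysics.QuantumFieldTheory.Site 4 (2 * S + 1)) 0 1 n n) := hSB
    _ ≤ _ := le_abs_self _

/-- **T2-sc from the `π`-plaquette floor:** `PlaquetteFloorSC → RatioStrongCoupling` (input (a) + the odd-torus RP chain + the arithmetic, all landed). -/
theorem ratioStrongCoupling_of_plaquetteFloorSC (hP : PlaquetteFloorSC) : RatioStrongCoupling :=
  ratioStrongCoupling_of_loopFloorSC (loopFloorSC_of_plaquetteFloorSC hP)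

/-- **T2-sc-window from the `π`-plaquette floor.** -/
theorem ratioStrongCouplingWindow_of_plaquetteFloorSC (hP : PlaquetteFloorSC) : RatioStrongCouplingWindow :=
  ratioStrongCouplingWindow_of_loopFloorSC (loopFloorSC_of_plaquetteFloorSC hP)

end Summit.QuantumFields.YangMills.Cruxes.IR.TensionRatio

end
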